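import Summits.Schanuel.Schanuel.Theorems.RigidCoreSparsityTwoShallow
import Summits.Schanuel.Schanuel.Theorems.RigidCoreSparsityTwoWildPiMonomialDepthCapRay
import Summits.Schanuel.Schanuel.Theorems.RigidCoreSparsityTwoWildPiPolynomialDepthCapRay

/-!
# Wild cusps with rational π-structure carry a finite depth cap; `SparsityTwo ↔` the three residual atoms (lead c4)

Line `cusp-germ-schneider-sparsity` for the crux `Summit.Schanuel.Schanuel.Theses.RigidCore.SparsityTwo`
(item stmt-Schanuel-0971, route route-Schanuel-RigidCore), lead c4 (2026-08-16).

The one atom of the line that had NO depth cap was A3, `WildCuspAtom` (`Theorems/RigidCoreSparsityTwoDefs.lean`): a wild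
(non-linear) `t`-jet, hits `A(w_n) + g(σ_n) ∈ ℤ` (`w_n = n^{1/e} = rayAbscissa e n`, `σ_n = w_n⁻¹`).  At a TORSION cusp the
σ-jet `A` has coefficients in `ℚ̄[ξ, ξ⁻¹]`, `ξ = (2πi)^{1/e}` (paper derivation in the lead's PROMOTE-c4.md: the change of
uniformiser `t = T σ` of `CuspDatum.link` has Taylor coefficients in `ℚ̄[ξ^{±1}]` when `ℓ₀ 0 ∈ 2πiℚ`), and an exact hit
makes a polynomial in `ξ` of bounded degree and height `n^{O(1)}` take the tiny value `−ξ^E g(σ_n)`.  When that structure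
is RATIONAL the polynomial descends to `ℤ[π]` with no norm bookkeeping, and the Nesterenko–Waldschmidt 1996 transcendence
measure of `π` (`Literature.NumberTheory.Transcendental.NesterenkoWaldschmidt1996_thm_2_2_holds`, PROVED in the tree:
`|P(π)| ≥ exp(−2·10⁶ d (log L + d log d)(1 + log d))`, polynomial in the length `L` for fixed degree `d`) caps the order of
the tail.  The two W-free ray theorems are LANDED:
* `stub_wildPiMonomialDepthCapRay` (`…WildPiMonomialDepthCapRay.lean`, p125323): π-MONOMIAL jets `q (2π)^{j/e} w^m + q₀`
  (`q, q₀ ∈ ℚ`, `j ≠ 0`) — the sub-linear / pure-power torsion class of Disproof §3a (root chain: `e = 3`,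
  `A = −(2π)^{−2/3} w − 1/2`);
* `stub_wildPiPolynomialDepthCapRay` (`…WildPiPolynomialDepthCapRay.lean`, p125073): jets in `ℚ[π, π⁻¹][n]` genuinely
  involving `π` — the `e = 1` torsion class of Disproof §3b (double-Cayley cubic: jet in `ℚ[π²][n]`).
This file gives their `CuspDatum` forms (`wildCusp_piMonomial_depthCap`, `wildCusp_piPolynomial_depthCap`: independent hits
are hits), derives `WildCuspAtom ↔ WildCuspAtomShallow` (the named residual appended to the Defs module by c4: the atom's data
plus SHALLOWNESS with respect to every valid cap of every rational-π presentation of the jet — valid caps exist by the two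
pockets, so the deep rational-π data are genuinely removed), and records the end state of the line after c4:

  `SparsityTwo ↔ WildCuspAtomShallow ∧ InhomogeneousCuspAtomShallow ∧ LinearCuspAtom`

— the crux is exactly three named exact-coincidence statements at a normalised cusp of a `ℚ`-curve, each BELOW the scale of
the one arithmetic input that applies to it (A1: Roth, `j ≤ e`; A2: Baker 1975 Thm 3.1, `j ≤ K_Baker`; A3 with rational
π-structure: NW1996, `ord g ≤ K_π`; A3 otherwise: no input known — algebraic non-rational Puiseux data would need norm
bookkeeping over the Puiseux field, non-torsion wild cusps an algebraic-independence measure for `π` and `log α`), and each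
SC(2)-implied (`namedAtoms_of_schanuelRank_two`).  No unproved facts; axioms standard.
-/

set_option linter.dupNamespace false

namespace Summit.Schanuel.Schanuel.Cruxes.SparsityTwo.CuspGermSchneiderSparsity

open Filter Topology Complex Polynomial Literature.NumberTheory.Transcendental
open scoped Real

/-! ## The caps in `CuspDatum` form -/

/-- **π-monomial depth cap, `CuspDatum` form** (registered anchor `wildCusp_piMonomial_depthCap`): for every class
`(e, m, j, q, q₀)` (`m ≥ 1`, `q ≠ 0`, `j ≠ 0`) there is `K` such that every cusp datum with `D.e = e`, σ-jet
`D.A = C (q (2π)^{j/e}) X^m + C q₀` and tail flat to order `K` has finitely many independent hits.  From the landed ray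
pocket `stub_wildPiMonomialDepthCapRay` (p125323): `indepHits ⊆ hits`. -/
theorem wildCusp_piMonomial_depthCap :
    ∀ (e m : ℕ) (j : ℤ) (q q₀ : ℚ), 0 < e → 0 < m → q ≠ 0 → j ≠ 0 →
      ∃ K : ℕ, ∀ D : CuspDatum, D.e = e →
        D.A = Polynomial.C ((q : ℂ) * (((2 * Real.pi) ^ ((j : ℝ) / (e : ℝ)) : ℝ) : ℂ)) * Polynomial.X ^ m
                + Polynomial.C (q₀ : ℂ) →
        (∀ i : ℕ, i ≤ K → iteratedDeriv i D.g 0 = 0) → D.indepHits.Finite := by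
  intro e m j q q₀ he hm hq hj
  obtain ⟨K, hK⟩ := stub_wildPiMonomialDepthCapRay e m j q q₀ he hm hq hj
  refine ⟨K, fun D hDe hA hflat => (hK D.g D.g_analytic hflat).subset ?_⟩
  rintro n ⟨-, L, hL⟩
  refine ⟨L, ?_⟩
  rw [← hL, hA, hDe]
  simp [Polynomial.eval_add, Polynomial.eval_mul, Polynomial.eval_pow, Polynomial.eval_C, Polynomial.eval_X]

/-- **π-polynomial depth cap, `CuspDatum` form** (registered anchor `wildCusp_piPolynomial_depthCap`): for every class
`(e, M, N, c)` with some `c m i ≠ 0`, `i ≠ 0`, there is `K` such that every cusp datum with `D.e = e`, σ-jet values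
`D.A(w_n) = ∑_{m ≤ N} ∑_{|i| ≤ M} c m i π^i n^m` and tail flat to order `K` has finitely many independent hits.  From the
landed ray pocket `stub_wildPiPolynomialDepthCapRay` (p125073). -/
theorem wildCusp_piPolynomial_depthCap :
    ∀ (e M N : ℕ) (c : ℕ → ℤ → ℚ), 0 < e →
      (∃ m : ℕ, ∃ i : ℤ, m ≤ N ∧ i ≠ 0 ∧ -(M : ℤ) ≤ i ∧ i ≤ M ∧ c m i ≠ 0) →
      ∃ K : ℕ, ∀ D : CuspDatum, D.e = e →
        (∀ n : ℕ, D.A.eval (rayAbscissa D.e n) =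
          ∑ m ∈ Finset.range (N + 1), ∑ i ∈ Finset.Icc (-(M : ℤ)) M,
            (c m i : ℂ) * (Real.pi : ℂ) ^ i * (n : ℂ) ^ m) →
        (∀ i : ℕ, i ≤ K → iteratedDeriv i D.g 0 = 0) → D.indepHits.Finite := by
  intro e M N c he hne
  obtain ⟨K, hK⟩ := stub_wildPiPolynomialDepthCapRay e M N c he hne
  refine ⟨K, fun D hDe hA hflat => (hK D.g D.g_analytic hflat).subset ?_⟩
  rintro n ⟨-, L, hL⟩
  refine ⟨L, ?_⟩
  rw [← hL, hA n, hDe]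

/-! ## A3 ↔ its shallow residual -/

/-- **`WildCuspAtom ↔ WildCuspAtomShallow`**: the wild atom is equivalent to its residual below every π-cap.  `→` ignores the
cap data (`wildCuspAtomShallow_of_atom`); `←`: a datum presented in a rational-π class with a valid cap `K` and flat to order
`K` is finite by that cap, every other datum satisfies the residual's shallowness hypotheses by contraposition.  (The caps
`wildCusp_piMonomial_depthCap` / `wildCusp_piPolynomial_depthCap` are what makes those hypotheses bite: valid caps exist for
every rational-π class, `exists_piMonomial_cap` / `exists_piPolynomial_cap` below.) -/
theorem wildCuspAtom_iff_shallow : WildCuspAtom ↔ WildCuspAtomShallow := by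
  refine ⟨wildCuspAtomShallow_of_atom, fun hsh D hnl hnc => ?_⟩
  classical
  by_cases h₁ : ∃ (m : ℕ) (j : ℤ) (q q₀ : ℚ) (K : ℕ), 0 < m ∧ q ≠ 0 ∧ j ≠ 0 ∧
      D.A = Polynomial.C ((q : ℂ) * (((2 * Real.pi) ^ ((j : ℝ) / (D.e : ℝ)) : ℝ) : ℂ)) * Polynomial.X ^ m
              + Polynomial.C (q₀ : ℂ) ∧
      (∀ D' : CuspDatum, D'.e = D.e →
        D'.A = Polynomial.C ((q : ℂ) * (((2 * Real.pi) ^ ((j : ℝ) / (D.e : ℝ)) : ℝ) : ℂ)) * Polynomial.X ^ m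
                + Polynomial.C (q₀ : ℂ) →
        (∀ i : ℕ, i ≤ K → iteratedDeriv i D'.g 0 = 0) → D'.indepHits.Finite) ∧
      (∀ i : ℕ, i ≤ K → iteratedDeriv i D.g 0 = 0)
  · obtain ⟨m, j, q, q₀, K, -, -, -, hA, hcap, hflat⟩ := h₁
    exact hcap D rfl hA hflat
  by_cases h₂ : ∃ (M N : ℕ) (c : ℕ → ℤ → ℚ) (K : ℕ),
      (∃ m : ℕ, ∃ i : ℤ, m ≤ N ∧ i ≠ 0 ∧ -(M : ℤ) ≤ i ∧ i ≤ M ∧ c m i ≠ 0) ∧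
      (∀ n : ℕ, D.A.eval (rayAbscissa D.e n) =
        ∑ m ∈ Finset.range (N + 1), ∑ i ∈ Finset.Icc (-(M : ℤ)) M,
          (c m i : ℂ) * (Real.pi : ℂ) ^ i * (n : ℂ) ^ m) ∧
      (∀ D' : CuspDatum, D'.e = D.e →
        (∀ n : ℕ, D'.A.eval (rayAbscissa D'.e n) =
          ∑ m ∈ Finset.range (N + 1), ∑ i ∈ Finset.Icc (-(M : ℤ)) M,
            (c m i : ℂ) * (Real.pi : ℂ) ^ i * (n : ℂ) ^ m) →
        (∀ i : ℕ, i ≤ K → iteratedDeriv i D'.g 0 = 0) → D'.indepHits.Finite) ∧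
      (∀ i : ℕ, i ≤ K → iteratedDeriv i D.g 0 = 0)
  · obtain ⟨M, N, c, K, -, hA, hcap, hflat⟩ := h₂
    exact hcap D rfl hA hflat
  refine hsh D hnl hnc ?_ ?_
  · intro m j q q₀ K hm hq hj hA hcap
    by_contra hfl
    push Not at hfl
    exact h₁ ⟨m, j, q, q₀, K, hm, hq, hj, hA, hcap, hfl⟩
  · intro M N c K hne hA hcap
    by_contra hfl
    push Not at hfl
    exact h₂ ⟨M, N, c, K, hne, hA, hcap, hfl⟩

/-- The cap hypotheses of `WildCuspAtomShallow` are INHABITED: every π-monomial class has a valid cap (so the residual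
genuinely excludes the deep data of that class). -/
theorem exists_piMonomial_cap (D : CuspDatum) (m : ℕ) (j : ℤ) (q q₀ : ℚ) (hm : 0 < m) (hq : q ≠ 0) (hj : j ≠ 0) :
    ∃ K : ℕ, ∀ D' : CuspDatum, D'.e = D.e →
      D'.A = Polynomial.C ((q : ℂ) * (((2 * Real.pi) ^ ((j : ℝ) / (D.e : ℝ)) : ℝ) : ℂ)) * Polynomial.X ^ m
              + Polynomial.C (q₀ : ℂ) →
      (∀ i : ℕ, i ≤ K → iteratedDeriv i D'.g 0 = 0) → D'.indepHits.Finite :=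
  wildCusp_piMonomial_depthCap D.e m j q q₀ D.e_pos hm hq hj

/-- The cap hypotheses of `WildCuspAtomShallow` are INHABITED: every π-polynomial class has a valid cap. -/
theorem exists_piPolynomial_cap (D : CuspDatum) (M N : ℕ) (c : ℕ → ℤ → ℚ)
    (hne : ∃ m : ℕ, ∃ i : ℤ, m ≤ N ∧ i ≠ 0 ∧ -(M : ℤ) ≤ i ∧ i ≤ M ∧ c m i ≠ 0) :
    ∃ K : ℕ, ∀ D' : CuspDatum, D'.e = D.e →
      (∀ n : ℕ, D'.A.eval (rayAbscissa D'.e n) =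
        ∑ m ∈ Finset.range (N + 1), ∑ i ∈ Finset.Icc (-(M : ℤ)) M,
          (c m i : ℂ) * (Real.pi : ℂ) ^ i * (n : ℂ) ^ m) →
      (∀ i : ℕ, i ≤ K → iteratedDeriv i D'.g 0 = 0) → D'.indepHits.Finite :=
  wildCusp_piPolynomial_depthCap D.e M N c D.e_pos hne

/-! ## The end state of the line after c4 -/

/-- **The crux is EQUIVALENT to its three residual atoms** (end state of line `cusp-germ-schneider-sparsity` after c4):
`SparsityTwo ↔ WildCuspAtomShallow ∧ InhomogeneousCuspAtomShallow ∧ LinearCuspAtom` — by c3's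
`sparsityTwo_iff_namedAtoms_shallow` and `wildCuspAtom_iff_shallow`. -/
theorem sparsityTwo_iff_residualAtoms :
    Summit.Schanuel.Schanuel.Theses.RigidCore.SparsityTwo ↔
      (WildCuspAtomShallow ∧ InhomogeneousCuspAtomShallow ∧ LinearCuspAtom) := by
  rw [sparsityTwo_iff_namedAtoms_shallow, wildCuspAtom_iff_shallow]

/-- The glue in curried form: the three residual atoms imply the crux. -/
theorem sparsityTwo_of_residualAtoms (h₃ : WildCuspAtomShallow) (h₂ : InhomogeneousCuspAtomShallow)
    (h₁ : LinearCuspAtom) : Summit.Schanuel.Schanuel.Theses.RigidCore.SparsityTwo :=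
  sparsityTwo_iff_residualAtoms.2 ⟨h₃, h₂, h₁⟩

end Summit.Schanuel.Schanuel.Cruxes.SparsityTwo.CuspGermSchneiderSparsity
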